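import Summits.QuantumFields.BalabanUV.Beta.CovariantGradientBox

/-!
# `Summit.QuantumFields.BalabanUV.Beta.MultiscaleGradientCovariantLocal` — THE GOOD-CASE CORE OF THE LOCAL INEQUALITY OF THE COVARIANT
# GRADIENT MEMBER FOR `levelOp` WITH ARBITRARY COLUMN-ORTHONORMAL TRANSPORTS, MODULO (FG) ∧ (SF): for an ABSTRACT field with fibre bounds
# on the `d_n`-ball about `x`, `‖(D_R f)(x,μ)‖ ≤ |c₀|√|Cp|·[(√|Cp|K₁ + √|Cp|K₂d(σ₂+σ₁²) + σ₁)·(M·16dΓ/n(x)) + K₂(θ/4+1)·n(x)·G/c₀²] + (2dK₂σ₁√|Cp|)·Y`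
# (file A1 of the levelOp twin of the owner's 19b under road P3's reduction «rough-`Rm` gradient member ⇐ flat interior estimate (FG) +
# sup member + ONE (3.35)-shaped binder (SF)», claim «COVARIANT-FLAT-SPLIT»; files A2 `MultiscaleGradientCovariantCases`, A3
# `MultiscaleGradientCovariantStep`, B `MultiscaleGradientMemberCovariant` complete it)

HONEST FRAMING (page 1 of everything in this cell).  Discharging `FlowStep.BetaPertH` would make Bałaban's ultraviolet
stability UNCONDITIONAL — a constructive-QFT result; it is NOT the continuum limit and NOT the Clay problem.  This module
discharges nothing of `BetaPertH`; it is [folklore] finite-dimensional bookkeeping about the MODEL operator, kernel-checked, by CO-OWNER #3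
of binder row D4 (unit `b2b-balaban-beta-d4-p3`, road P3 «reduction road», gen 13), in the OWNER's file-19b setting and letters
(`MultiscaleGradientMember`, an4-g46).  HONEST DEPENDENCY: continuum YM on T⁴ ⇐ BetaPertH ∧ nine spine estimates (0/9 proved);
BetaPertH ⇐ (D1) ∧ (D4) ∧ CAP+tail; G-an2-4 gates asym, D1 and NE2/3/4.

THE POINT (O.2 item (i-b) at MODEL level — the owner's census E-an4-141d: «COVARIANT — FALSE level-free without (3.35)»).  File 19b
gives the gradient member (3.42)₂'s shape for `levelOp` with FLAT transport modulo (FG).  For ROUGH column-orthonormal transports road P3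
reduces the member to (FG) + the CLOSED sup member + ONE (3.35)-shaped binder (SF) («on every box of the assembly — centre `x₀`, natural radius
`R = ⌊n(x₀)θ/4⌋` — there is a gauge in which the transporters deviate from `1` by `≤ σ₁/(R+1)` and vary along their own direction by `≤ σ₂/(R+1)²`»).  THIS FILE is the per-bond step:
in 19b's EXACT section setting minus `hflat`, plus `hSF`, at a bond `b₀ = (x, μ)` with `R₀ = ⌊n(x)θ/4⌋`:
* GOOD CASE (`R₀ ≥ 1`, `10R₀ + 4 ≤ N_j`): the ball `dist(·,x) ≤ 2R₀ + 3` sits in the `d_n`-ball of radius `1`; there the CLOSED sup member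
  (file 17) gives `‖f‖ ≤ √|Cp|·𝔅Γ²e^δ·n(x)²e^{−δD}m`, the equation `D_R*D_R f = u − Σ_l a_lG_lᵀG_l f` (ANY `Rm`) with 19a's unit-ball reading
  of the averaging part gives `‖D_R*D_R f‖ ≤ √|Cp|(e^{δ(2d+1)} + a_max√|Cp|𝔅e^{δ(4d+1)})e^{−δD}m`; `CovariantGradientBox.covariant_fdiff_le_box`
  in the (SF) gauge of the box `(x, R₀)` with `ε = σ₁/(R₀+1)`, `γ = σ₂/(R₀+1)²`, `D₁ = Y`, and 19b's arithmetic (`1/(R₀+1) < 16dΓ/n(x)`,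
  `R₀ + 1 ≤ (θ/4 + 1)n(x)`) give **`‖(D_R f)(b₀)‖ ≤ T_cov·n(x)e^{−δD}m + (2dK₂σ₁√|Cp|)·Y`** — the feedback coefficient is SCALE-FREE;
* SMALL CASE (otherwise `n(x) ≤ 16dΓ`): the trivial bound `‖(D_R f)(b₀)‖ ≤ |c₀|(‖f(b₀₊)‖ + ‖f(b₀₋)‖)`.
`T_cov = |c₀|√|Cp|·[𝔅(Γ²e^δ + 1)·16dΓ + √|Cp|K₁𝔅Γ²e^δ·16dΓ + √|Cp|K₂(θ/4 + 1)(e^{δ(2d+1)} + a_max√|Cp|𝔅e^{δ(4d+1)})/c₀²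
          + √|Cp|K₂·d(σ₂ + σ₁²)·𝔅Γ²e^δ·16dΓ + σ₁𝔅Γ²e^δ·16dΓ]` — constants seeing `d, c₀, c_max, a_max, C, κ, L, A, R, |Cp|, K₁, K₂, σ₁, σ₂`
ONLY.  File B (`MultiscaleGradientMemberCovariant`) runs `ScaleBootstrap.bootstrap_of_local` over the bonds with this local inequality.
WHAT THIS IS NOT: not a bound on Bałaban's ∇_UG′(U); (FG) and (SF) are HYPOTHESIS shapes ((3.35) p. 396 is a LOCATOR, not asserted;
[B4] Lemma 2.2's chain is NOT reproduced); row D4 readiness width 0; D4 DISCHARGE NO DATE.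

WHAT IS CERTIFIED (kernel, 0 sorry, 0 def): §1 `norm_covD_le_trivial` (‖(D_R f)(b)‖ ≤ |c_b|(‖f(b₊)‖ + ‖f(b₋)‖) for an isometry);
§2 `sdist_le_one_of_dist_le_box` (the box `dist ≤ 2R₀+3` sits in the `d_n`-unit ball), `sf_binder_of_flat` (NON-VACUITY: the flat transport
satisfies (SF) with `σ₁ = σ₂ = 0`, gauge `g ≡ 1`), **`covariant_grad_core`** — the good-case core for an ABSTRACT field `f`: given `R₀ ≥ 1` with room, `R₀ ≤ n(x)θ/4 < R₀+1`, fibre bounds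
`‖f‖ ≤ √|Cp|·M` and `‖D_R*D_R f‖ ≤ G` on the `d_n`-ball of radius `1` about `x`, (FG), (SF) and a bound `Y` of `‖D_R f‖` near the box:
the displayed inequality (module 4 `covariant_fdiff_le_box` in the (SF) gauge of the box `(x,R₀)`, `ε = σ₁/(R₀+1)`, `γ = σ₂/(R₀+1)²`;
16a `sdist_le_of_dist_le` puts the boxes `dist ≤ 2R₀+2, 2R₀+3` inside the `d_n`-ball; 19b's arithmetic `1/(R₀+1) < 16dΓ/n(x)`,
`R₀+1 ≤ (θ/4+1)n(x)`).  LOCATORS (shape only; ABSOLUTE RULE): [Balaban1985BackgroundPropagators] (3.35) p. 396, Thm 3.1 (3.42) p. 397;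
[Balaban1983RegularityDecay] Lemma 2.2 (2.17) pp. 577–578.  NOT BetaPertH, NOT continuum, NOT Clay, NOT summit progress.
-/

open scoped BigOperators
open Finset

namespace Summit.QuantumFields.BalabanUV.Beta.MultiscaleGradientCovariantLocal

open Summit.QuantumFields.BalabanUV.Beta.BoxPoincare (Box)
open Summit.QuantumFields.BalabanUV.Beta.MultiscaleCoerciveTorus
open Summit.QuantumFields.BalabanUV.Beta.MultiscaleDistance
open Summit.QuantumFields.BalabanUV.Beta.MultiscaleDistanceMetric (sdist_comm sdist_triangle_torus)
open Summit.QuantumFields.BalabanUV.Beta.MultiscaleDecayBudget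
open Summit.QuantumFields.BalabanUV.Beta.MultiscaleDecay (decay_levelOp)
open Summit.QuantumFields.BalabanUV.Beta.AccretiveCombesThomasSandwichSite (sdist_corner_thresholds)
open Summit.QuantumFields.BalabanUV.Beta.MultiscaleBoxDistance (sdist_le_of_dist_le)
open Summit.QuantumFields.BalabanUV.Beta.MultiscaleRegularityClosed (real_sup_levelOp_inverse_le)
open Summit.QuantumFields.BalabanUV.Beta.MultiscaleGradientSource (abs_le_on_unit_ball abs_levelSum_le_on_unit_ball)
open Summit.QuantumFields.BalabanUV.Beta.SubsolutionMeanValueBox (Cmv Cmv_pos)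
open Summit.QuantumFields.BalabanUV.Beta.CovariantKato (sqrt_sum_sq_add_le sqrt_sum_sq_smul sqrt_sum_sq_Rm)
open Summit.QuantumFields.BalabanUV.Beta.CovariantGradientBox (norm_le_sqrt_card_of_abs_le covariant_fdiff_le_box)
open Literature.MathematicalPhysics.QuantumFieldTheory.Balaban1983to89
open Literature.MathematicalPhysics.QuantumFieldTheory.Balaban1983to89.B9Thm37Glue (covD covDT covD_apply covDT_apply)
open Literature.MathematicalPhysics.QuantumFieldTheory.Balaban1983to89.B9Thm37GluePU (bsrc btgt bsrc_apply btgt_apply)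
open Literature.MathematicalPhysics.QuantumFieldTheory.Balaban1983to89.B9Thm37GlueTorusCov (tblk)
open Literature.MathematicalPhysics.QuantumFieldTheory.Balaban1983to89.B9Thm37GlueTorusCovLevels (levelOp levelSum)
open B5TorusCover (UT Ctr ctrU)
open B5Leibniz121 (up dn)

noncomputable section

variable {d : ℕ} {N : Fin d → ℕ} [∀ i, NeZero (N i)]

/-! ## §1 The trivial bound on a covariant difference -/

/-- **`‖(D_R f)(b)‖ ≤ |c_b|·(‖f(b₊)‖ + ‖f(b₋)‖)`** for a column-orthonormal `R_b` (fibre norms). [folklore] -/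
theorem norm_covD_le_trivial {Cp : Type} [Fintype Cp] [DecidableEq Cp] (c : UT N × Fin d → ℝ) (Rm : UT N × Fin d → Cp → Cp → ℝ)
    (hRm : ∀ b i j, ∑ k, Rm b k i * Rm b k j = if i = j then (1 : ℝ) else 0) (f : UT N × Cp → ℝ) (b : UT N × Fin d) :
    Real.sqrt (∑ i, covD bsrc btgt c Rm f (b, i) ^ 2) ≤
      |c b| * (Real.sqrt (∑ j, f (btgt b, j) ^ 2) + Real.sqrt (∑ i, f (bsrc b, i) ^ 2)) := by
  have h : ∀ i, covD bsrc btgt c Rm f (b, i) = c b * ((∑ j, Rm b i j * f (btgt b, j)) + -f (bsrc b, i)) := fun i => by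
    rw [covD_apply]; ring
  simp only [h]
  rw [sqrt_sum_sq_smul]
  refine mul_le_mul_of_nonneg_left ?_ (abs_nonneg _)
  calc Real.sqrt (∑ i, ((∑ j, Rm b i j * f (btgt b, j)) + -f (bsrc b, i)) ^ 2)
      ≤ Real.sqrt (∑ i, (∑ j, Rm b i j * f (btgt b, j)) ^ 2) + Real.sqrt (∑ i, (-f (bsrc b, i)) ^ 2) := sqrt_sum_sq_add_le _ _
    _ = Real.sqrt (∑ j, f (btgt b, j) ^ 2) + Real.sqrt (∑ i, f (bsrc b, i) ^ 2) := by
        rw [sqrt_sum_sq_Rm (Rm b) (hRm b) (fun j => f (btgt b, j))]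
        congr 2; exact Finset.sum_congr rfl fun i _ => by rw [neg_sq]

/-! ## §2 The GOOD-CASE core: abstract field, bounds on the `d_n`-ball, the (SF) gauge and module 4 -/

section Core

variable [NeZero d] {Cp J K : Type} [Fintype Cp] [DecidableEq Cp]
  [Fintype J] [Fintype K] [DecidableEq K] (S : J → ℕ) (hS : ∀ l, 1 ≤ S l) (hdivS : ∀ l i, S l ∣ N i) (lvl : K → J)
  (zc : (k : K) → Ctr N (S (lvl k)))
  (hcover : ∀ x : UT N, ∃ k, ∃ v : Box d (S (lvl k)), cellPt S hS hdivS lvl zc k v = x)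
  (Rm : UT N × Fin d → Cp → Cp → ℝ) (hRm : ∀ b i j, ∑ k, Rm b k i * Rm b k j = if i = j then (1 : ℝ) else 0)
  (c : UT N × Fin d → ℝ) {c₀ : ℝ} (hcc : ∀ b, c b = c₀) (hc₀ : c₀ ≠ 0)
  {L : ℕ} (hL : 1 ≤ L) (e : J → ℕ) (hSe : ∀ l, S l = L ^ e l) {R : ℝ} (hR : 0 < R) {A : ℕ}
  (hadd : ∀ x y : UT N, |(e (lvl (cellOf S hS hdivS lvl zc hcover x)) : ℝ) - e (lvl (cellOf S hS hdivS lvl zc hcover y))| ≤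
    A + sdist bsrc btgt (siteScale S hS hdivS lvl zc hcover) x y / R)

include hL hSe hR hadd hRm hcc hc₀

omit [Fintype J] [Fintype K] [DecidableEq K] hRm hcc hc₀ in
/-- **The box `dist(·,x) ≤ 2R₀ + 3` sits in the `d_n`-ball of radius `1` about `x`** when `1 ≤ R₀ ≤ n(x)θ/4` (`θ = 1/(4dΓ)`):
`d(2R₀+3)Γ ≤ (5/16)·n(x)` and 16a `sdist_le_of_dist_le`. [folklore] -/
theorem sdist_le_one_of_dist_le_box {Γ θ : ℝ} (hΓ : Γ = (L : ℝ) ^ A * Real.exp (Real.log L / R * (4 * d + 1)))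
    (hθ : θ = 1 / (4 * d * Γ)) (x : UT N) {R₀ : ℕ} (hR1 : 1 ≤ R₀)
    (hR₀le : (R₀ : ℝ) ≤ (siteScale S hS hdivS lvl zc hcover x : ℝ) * θ / 4) {y : UT N} (hy : dist y x ≤ 2 * R₀ + 3) :
    sdist bsrc btgt (siteScale S hS hdivS lvl zc hcover) y x ≤ 1 := by
  set n := siteScale S hS hdivS lvl zc hcover with hn
  have hd1 : (1 : ℝ) ≤ d := by exact_mod_cast Nat.one_le_iff_ne_zero.mpr (NeZero.ne d)
  have h516 : (5 : ℝ) / 16 ≤ 4 * d + 1 := by linarith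
  have hL1 : (1 : ℝ) ≤ L := by exact_mod_cast hL
  have ht0 : 0 ≤ Real.log L / R := div_nonneg (Real.log_nonneg hL1) hR.le
  have hΓ1 : 1 ≤ Γ := by
    rw [hΓ]
    exact one_le_mul_of_one_le_of_one_le (one_le_pow₀ hL1) (Real.one_le_exp (mul_nonneg ht0 (by positivity)))
  have hΓ0 : 0 < Γ := by linarith
  have hθΓ : θ * (16 * d * Γ) = 4 := by rw [hθ]; field_simp; ring
  have hnpos : (0 : ℝ) < (n x : ℝ) := by exact_mod_cast one_le_siteScale S hS hdivS lvl zc hcover x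
  have hgr : ∀ y, n y = L ^ (e (lvl (cellOf S hS hdivS lvl zc hcover y))) := fun y => by rw [hn, siteScale, hSe]
  have hR1r : (1 : ℝ) ≤ R₀ := by exact_mod_cast hR1
  have hprod : (d : ℝ) * (2 * R₀ + 2) * Γ ≤ 1 / 4 * n x := by
    have h4R : (2 * (R₀ : ℝ) + 2) ≤ 4 * R₀ := by linarith
    calc (d : ℝ) * (2 * R₀ + 2) * Γ ≤ d * (4 * R₀) * Γ := by gcongr
      _ ≤ d * (4 * (n x * θ / 4)) * Γ := by gcongr
      _ = n x * (θ * (16 * d * Γ)) / 16 := by ring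
      _ = 1 / 4 * n x := by rw [hθΓ]; ring
  have hballrad3 : ((d * (2 * R₀ + 3) : ℕ) : ℝ) * ((L : ℝ) ^ A * Real.exp (Real.log L / R * (4 * d + 1))) / n x ≤ 5 / 16 := by
    rw [← hΓ, div_le_iff₀ hnpos]
    push_cast
    have hdΓ0 : 0 ≤ (d : ℝ) * Γ := by positivity
    have hpos : 0 ≤ (d : ℝ) * Γ * ((R₀ : ℝ) - 1) := mul_nonneg hdΓ0 (by linarith)
    have key : 5 / 4 * ((d : ℝ) * (2 * R₀ + 2) * Γ) - (d : ℝ) * (2 * R₀ + 3) * Γ = (d : ℝ) * Γ * ((R₀ : ℝ) - 1) / 2 := by ring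
    linarith
  have hcast : ((2 * R₀ + 3 : ℕ) : ℝ) = 2 * (R₀ : ℝ) + 3 := by push_cast; ring
  exact ((sdist_le_of_dist_le n (one_le_siteScale S hS hdivS lvl zc hcover) hL
    (fun y => e (lvl (cellOf S hS hdivS lvl zc hcover y))) hgr hR x (fun y => hadd y x) (2 * R₀ + 3)
    (hballrad3.trans h516) (by rw [hcast]; exact hy)).trans hballrad3).trans (by norm_num)

omit [Fintype J] [Fintype K] [DecidableEq K] in
/-- **THE GOOD-CASE CORE.**  For an ARBITRARY field `f` on the torus with fibre-norm bounds on the `d_n`-ball of radius `1` about `x`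
(`‖f‖ ≤ √|Cp|·M`, `‖D_R*D_R f‖ ≤ G`), a radius `R₀ ≥ 1` with `R₀ ≤ n(x)θ/4 < R₀ + 1` and room `10R₀ + 4 ≤ N_j`, the flat binder (FG) and the
(3.35)-shaped binder (SF) (both HYPOTHESES — ABSOLUTE RULE), and a bound `Y` of `‖D_R f‖` on the bonds starting in `{dist(·,x) ≤ 2R₀+3}`:
`‖(D_R f)((x,μ),·)‖ ≤ |c₀|√|Cp|·[(√|Cp|K₁ + √|Cp|K₂·d(σ₂+σ₁²) + σ₁)·(M·16dΓ/n(x)) + K₂(θ/4+1)·n(x)·G/c₀²] + (2dK₂σ₁√|Cp|)·Y`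
(`CovariantGradientBox.covariant_fdiff_le_box` in the (SF) gauge of the box `(x, R₀)` with `ε = σ₁/(R₀+1)`, `γ = σ₂/(R₀+1)²`; the boxes
`dist ≤ 2R₀+2`, `2R₀+3` sit in the `d_n`-ball of radius `1` by 16a `sdist_le_of_dist_le`). [folklore] -/
theorem covariant_grad_core {Γ θ : ℝ} (hΓ : Γ = (L : ℝ) ^ A * Real.exp (Real.log L / R * (4 * d + 1))) (hθ : θ = 1 / (4 * d * Γ))
    {K₁ K₂ : ℝ} (hK₁ : 0 ≤ K₁) (hK₂ : 0 ≤ K₂)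
    (hFG : ∀ (x₀ : UT N) (R : ℕ), 1 ≤ R → (∀ i, 10 * R + 4 ≤ N i) → ∀ (w : UT N → ℝ) (M G : ℝ),
      (∀ x ∈ univ.filter (fun x : UT N => dist x x₀ ≤ 2 * R + 2), |w x| ≤ M) →
      (∀ x ∈ univ.filter (fun x : UT N => dist x x₀ ≤ 2 * R + 2),
        |((∑ b ∈ univ.filter (fun b : UT N × Fin d => btgt b = x), c b ^ 2) +
              ∑ b ∈ univ.filter (fun b : UT N × Fin d => bsrc b = x), c b ^ 2) * w x -
            ((∑ b ∈ univ.filter (fun b : UT N × Fin d => btgt b = x), c b ^ 2 * w (bsrc b)) +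
              ∑ b ∈ univ.filter (fun b : UT N × Fin d => bsrc b = x), c b ^ 2 * w (btgt b))| ≤ G) →
      ∀ μ, |w (up x₀ μ) - w x₀| ≤ K₁ * M / ((R : ℝ) + 1) + K₂ * ((R : ℝ) + 1) * G / c₀ ^ 2)
    {σ₁ σ₂ : ℝ} (hσ₁ : 0 ≤ σ₁) (hσ₂ : 0 ≤ σ₂)
    (hSF : ∀ (x₀ : UT N) (R : ℕ), 1 ≤ R → (R : ℝ) ≤ (siteScale S hS hdivS lvl zc hcover x₀ : ℝ) * θ / 4 →
      (siteScale S hS hdivS lvl zc hcover x₀ : ℝ) * θ / 4 < R + 1 → ∃ g : UT N → Cp → Cp → ℝ, ∃ Rg : UT N × Fin d → Cp → Cp → ℝ,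
      (∀ x i j, ∑ k, g x k i * g x k j = if i = j then (1 : ℝ) else 0) ∧
      (∀ b i j, Rg b i j = ∑ k, g (bsrc b) i k * ∑ l, Rm b k l * g (btgt b) j l) ∧
      (∀ b : UT N × Fin d, dist (bsrc b) x₀ ≤ 2 * R + 3 → ∀ v : Cp → ℝ,
        Real.sqrt (∑ i, (∑ j, (Rg b i j - if i = j then (1 : ℝ) else 0) * v j) ^ 2) ≤
          σ₁ / ((R : ℝ) + 1) * Real.sqrt (∑ j, v j ^ 2)) ∧
      (∀ x ∈ univ.filter (fun x : UT N => dist x x₀ ≤ 2 * R + 2), ∀ μ (v : Cp → ℝ),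
        Real.sqrt (∑ i, (∑ j, (Rg (dn x μ, μ) i j - Rg (x, μ) i j) * v j) ^ 2) ≤
          σ₂ / ((R : ℝ) + 1) ^ 2 * Real.sqrt (∑ j, v j ^ 2)))
    (f : UT N × Cp → ℝ) (x : UT N) (μ : Fin d) {R₀ : ℕ} (hR1 : 1 ≤ R₀) (hroom : ∀ j, 10 * R₀ + 4 ≤ N j)
    (hR₀le : (R₀ : ℝ) ≤ (siteScale S hS hdivS lvl zc hcover x : ℝ) * θ / 4)
    (hR₀lt : (siteScale S hS hdivS lvl zc hcover x : ℝ) * θ / 4 < R₀ + 1)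
    {M G Y : ℝ} (hM0 : 0 ≤ M) (hG0 : 0 ≤ G) (hY0 : 0 ≤ Y)
    (hαF : ∀ y : UT N, sdist bsrc btgt (siteScale S hS hdivS lvl zc hcover) y x ≤ 1 →
      Real.sqrt (∑ j, f (y, j) ^ 2) ≤ Real.sqrt (Fintype.card Cp) * M)
    (hβF : ∀ y : UT N, sdist bsrc btgt (siteScale S hS hdivS lvl zc hcover) y x ≤ 1 →
      Real.sqrt (∑ j, covDT bsrc btgt c Rm (covD bsrc btgt c Rm f) (y, j) ^ 2) ≤ G)
    (hY : ∀ b : UT N × Fin d, dist (bsrc b) x ≤ 2 * R₀ + 3 → Real.sqrt (∑ i, covD bsrc btgt c Rm f (b, i) ^ 2) ≤ Y) :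
    Real.sqrt (∑ i, covD bsrc btgt c Rm f ((x, μ), i) ^ 2) ≤
      |c₀| * Real.sqrt (Fintype.card Cp) *
          ((Real.sqrt (Fintype.card Cp) * K₁ + Real.sqrt (Fintype.card Cp) * K₂ * (d * (σ₂ + σ₁ ^ 2)) + σ₁) *
              (M * (16 * d * Γ) / siteScale S hS hdivS lvl zc hcover x) +
            K₂ * (θ / 4 + 1) * siteScale S hS hdivS lvl zc hcover x * G / c₀ ^ 2)
        + 2 * d * K₂ * σ₁ * Real.sqrt (Fintype.card Cp) * Y := by
  classical
  set n := siteScale S hS hdivS lvl zc hcover with hn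
  set Kc := Real.sqrt (Fintype.card Cp) with hKc
  -- positivity
  have hd1 : (1 : ℝ) ≤ d := by exact_mod_cast Nat.one_le_iff_ne_zero.mpr (NeZero.ne d)
  have hd0 : (0 : ℝ) < d := by linarith
  have hL1 : (1 : ℝ) ≤ L := by exact_mod_cast hL
  have ht0 : 0 ≤ Real.log L / R := div_nonneg (Real.log_nonneg hL1) hR.le
  have hΓ1 : 1 ≤ Γ := by
    rw [hΓ]
    exact one_le_mul_of_one_le_of_one_le (one_le_pow₀ hL1) (Real.one_le_exp (mul_nonneg ht0 (by positivity)))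
  have hΓ0 : 0 < Γ := by linarith
  have hθΓ : θ * (16 * d * Γ) = 4 := by rw [hθ]; field_simp; ring
  have hc2 : (0 : ℝ) < c₀ ^ 2 := by positivity
  have hKc0 : 0 ≤ Kc := Real.sqrt_nonneg _
  have hnpos : ∀ y, (0 : ℝ) < (n y : ℝ) := fun y => by exact_mod_cast one_le_siteScale S hS hdivS lvl zc hcover y
  have hn1 : ∀ y, (1 : ℝ) ≤ (n y : ℝ) := fun y => by exact_mod_cast one_le_siteScale S hS hdivS lvl zc hcover y
  have hgr : ∀ y, n y = L ^ (e (lvl (cellOf S hS hdivS lvl zc hcover y))) := fun y => by rw [hn, siteScale, hSe]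
  have hR1r : (1 : ℝ) ≤ R₀ := by exact_mod_cast hR1
  have hR1' : (0 : ℝ) < (R₀ : ℝ) + 1 := by positivity
  -- the box `dist ≤ 2R₀+2` sits in the `d_n`-ball of radius 1 about `x`
  have hball' : ∀ y ∈ univ.filter (fun y : UT N => dist y x ≤ 2 * R₀ + 2), sdist bsrc btgt n y x ≤ 1 := fun y hy =>
    sdist_le_one_of_dist_le_box S hS hdivS lvl zc hcover hL e hSe hR hadd hΓ hθ x hR1 hR₀le (by linarith [(mem_filter.mp hy).2])
  -- the gauge and module 4
  obtain ⟨g, Rg, hg, hRg, hdev, hgrad⟩ := hSF x R₀ hR1 hR₀le hR₀lt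
  have hε0 : 0 ≤ σ₁ / ((R₀ : ℝ) + 1) := by positivity
  have hγ0 : 0 ≤ σ₂ / ((R₀ : ℝ) + 1) ^ 2 := by positivity
  have hbox := covariant_fdiff_le_box hcc hc₀ Rm hRm g hg Rg hRg x hR1 hε0 hγ0 hdev hgrad hK₁ hK₂ (hFG x R₀ hR1 hroom)
    f (fun p => ∑ j, g p.1 p.2 j * f (p.1, j)) (fun _ _ => rfl) hY0
    (fun y hy => hαF y (hball' y hy)) (fun y hy => hβF y (hball' y hy)) hY μ
  -- `1/(R₀+1) ≤ 16dΓ/n(x)` and `R₀ + 1 ≤ (θ/4 + 1)·n(x)`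
  have hnR : (n x : ℝ) ≤ ((R₀ : ℝ) + 1) * (16 * d * Γ) := by
    have : (n x : ℝ) * θ / 4 * (16 * d * Γ) < ((R₀ : ℝ) + 1) * (16 * d * Γ) :=
      mul_lt_mul_of_pos_right hR₀lt (by positivity)
    have e1 : (n x : ℝ) * θ / 4 * (16 * d * Γ) = n x * (θ * (16 * d * Γ)) / 4 := by ring
    rw [e1, hθΓ] at this
    linarith
  have hKM0 : 0 ≤ Kc * M := mul_nonneg hKc0 hM0
  have hinv : Kc * M / ((R₀ : ℝ) + 1) ≤ Kc * M * (16 * d * Γ) / n x := by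
    rw [div_le_div_iff₀ hR1' (hnpos x)]
    calc Kc * M * (n x : ℝ) ≤ Kc * M * (((R₀ : ℝ) + 1) * (16 * d * Γ)) := mul_le_mul_of_nonneg_left hnR hKM0
      _ = Kc * M * (16 * d * Γ) * ((R₀ : ℝ) + 1) := by ring
  have hRle : (R₀ : ℝ) + 1 ≤ (θ / 4 + 1) * n x := by
    have : (θ / 4 + 1) * (n x : ℝ) = n x * θ / 4 + n x := by ring
    rw [this]; linarith [hn1 x]
  -- the five pieces
  have hP2 : |c₀| * Kc * (K₁ * (Kc * M) / ((R₀ : ℝ) + 1)) ≤ |c₀| * Kc * (Kc * K₁ * (M * (16 * d * Γ) / n x)) := by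
    have h1 : K₁ * (Kc * M) / ((R₀ : ℝ) + 1) ≤ K₁ * (Kc * M * (16 * d * Γ) / n x) := by
      rw [mul_div_assoc]; exact mul_le_mul_of_nonneg_left hinv hK₁
    calc |c₀| * Kc * (K₁ * (Kc * M) / ((R₀ : ℝ) + 1)) ≤ |c₀| * Kc * (K₁ * (Kc * M * (16 * d * Γ) / n x)) :=
          mul_le_mul_of_nonneg_left h1 (by positivity)
      _ = |c₀| * Kc * (Kc * K₁ * (M * (16 * d * Γ) / n x)) := by ring
  have hP3 : |c₀| * Kc * (K₂ * ((R₀ : ℝ) + 1) * G / c₀ ^ 2) ≤ |c₀| * Kc * (K₂ * (θ / 4 + 1) * n x * G / c₀ ^ 2) := by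
    have h1 : K₂ * ((R₀ : ℝ) + 1) * G ≤ K₂ * ((θ / 4 + 1) * n x) * G :=
      mul_le_mul_of_nonneg_right (mul_le_mul_of_nonneg_left hRle hK₂) hG0
    calc |c₀| * Kc * (K₂ * ((R₀ : ℝ) + 1) * G / c₀ ^ 2) ≤ |c₀| * Kc * (K₂ * ((θ / 4 + 1) * n x) * G / c₀ ^ 2) :=
          mul_le_mul_of_nonneg_left (div_le_div_of_nonneg_right h1 hc2.le) (by positivity)
      _ = |c₀| * Kc * (K₂ * (θ / 4 + 1) * n x * G / c₀ ^ 2) := by ring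
  have hcc2 : |c₀| * |c₀| = c₀ ^ 2 := by rw [abs_mul_abs_self, sq]
  have hPY : |c₀| * Kc * (K₂ * ((R₀ : ℝ) + 1) * (2 * d * |c₀| * (σ₁ / ((R₀ : ℝ) + 1)) * Y) / c₀ ^ 2) =
      2 * d * K₂ * σ₁ * Kc * Y := by
    rw [← hcc2]
    field_simp
  have hP4 : |c₀| * Kc * (K₂ * ((R₀ : ℝ) + 1) *
      (c₀ ^ 2 * d * (σ₂ / ((R₀ : ℝ) + 1) ^ 2 + (σ₁ / ((R₀ : ℝ) + 1)) ^ 2) * (Kc * M)) / c₀ ^ 2) ≤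
      |c₀| * Kc * (Kc * K₂ * (d * (σ₂ + σ₁ ^ 2)) * (M * (16 * d * Γ) / n x)) := by
    have e1 : |c₀| * Kc * (K₂ * ((R₀ : ℝ) + 1) *
        (c₀ ^ 2 * d * (σ₂ / ((R₀ : ℝ) + 1) ^ 2 + (σ₁ / ((R₀ : ℝ) + 1)) ^ 2) * (Kc * M)) / c₀ ^ 2) =
        |c₀| * Kc * (K₂ * (d * (σ₂ + σ₁ ^ 2))) * (Kc * M / ((R₀ : ℝ) + 1)) := by
      field_simp
    rw [e1]
    calc |c₀| * Kc * (K₂ * (d * (σ₂ + σ₁ ^ 2))) * (Kc * M / ((R₀ : ℝ) + 1))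
        ≤ |c₀| * Kc * (K₂ * (d * (σ₂ + σ₁ ^ 2))) * (Kc * M * (16 * d * Γ) / n x) :=
          mul_le_mul_of_nonneg_left hinv (by positivity)
      _ = |c₀| * Kc * (Kc * K₂ * (d * (σ₂ + σ₁ ^ 2)) * (M * (16 * d * Γ) / n x)) := by ring
  have hP5 : |c₀| * (σ₁ / ((R₀ : ℝ) + 1) * (Kc * M)) ≤ |c₀| * Kc * (σ₁ * (M * (16 * d * Γ) / n x)) := by
    have e1 : |c₀| * (σ₁ / ((R₀ : ℝ) + 1) * (Kc * M)) = |c₀| * σ₁ * (Kc * M / ((R₀ : ℝ) + 1)) := by ring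
    rw [e1]
    calc |c₀| * σ₁ * (Kc * M / ((R₀ : ℝ) + 1)) ≤ |c₀| * σ₁ * (Kc * M * (16 * d * Γ) / n x) :=
          mul_le_mul_of_nonneg_left hinv (by positivity)
      _ = |c₀| * Kc * (σ₁ * (M * (16 * d * Γ) / n x)) := by ring
  -- regroup module 4's bound and conclude
  have hregroup : |c₀| * (Kc * (K₁ * (Kc * M) / ((R₀ : ℝ) + 1) + K₂ * ((R₀ : ℝ) + 1) *
      (G + 2 * d * |c₀| * (σ₁ / ((R₀ : ℝ) + 1)) * Y +
        c₀ ^ 2 * d * (σ₂ / ((R₀ : ℝ) + 1) ^ 2 + (σ₁ / ((R₀ : ℝ) + 1)) ^ 2) * (Kc * M)) / c₀ ^ 2) +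
      σ₁ / ((R₀ : ℝ) + 1) * (Kc * M)) =
      |c₀| * Kc * (K₁ * (Kc * M) / ((R₀ : ℝ) + 1)) + |c₀| * Kc * (K₂ * ((R₀ : ℝ) + 1) * G / c₀ ^ 2) +
        |c₀| * Kc * (K₂ * ((R₀ : ℝ) + 1) * (2 * d * |c₀| * (σ₁ / ((R₀ : ℝ) + 1)) * Y) / c₀ ^ 2) +
        |c₀| * Kc * (K₂ * ((R₀ : ℝ) + 1) *
          (c₀ ^ 2 * d * (σ₂ / ((R₀ : ℝ) + 1) ^ 2 + (σ₁ / ((R₀ : ℝ) + 1)) ^ 2) * (Kc * M)) / c₀ ^ 2) +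
        |c₀| * (σ₁ / ((R₀ : ℝ) + 1) * (Kc * M)) := by ring
  calc Real.sqrt (∑ i, covD bsrc btgt c Rm f ((x, μ), i) ^ 2)
      ≤ _ := hbox
    _ = _ := hregroup
    _ ≤ |c₀| * Kc * (Kc * K₁ * (M * (16 * d * Γ) / n x)) + |c₀| * Kc * (K₂ * (θ / 4 + 1) * n x * G / c₀ ^ 2) +
          2 * d * K₂ * σ₁ * Kc * Y + |c₀| * Kc * (Kc * K₂ * (d * (σ₂ + σ₁ ^ 2)) * (M * (16 * d * Γ) / n x)) +
          |c₀| * Kc * (σ₁ * (M * (16 * d * Γ) / n x)) := by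
        rw [hPY]; linarith [hP2, hP3, hP4, hP5]
    _ = _ := by ring


omit [NeZero d] [Fintype J] [Fintype K] [DecidableEq K] hL hSe hR hadd hRm hcc hc₀ in
/-- **NON-VACUITY OF THE (SF) BINDER: the FLAT transport satisfies it with `σ₁ = σ₂ = 0`** (gauge `g ≡ 1`, `R^g = Rm ≡ 1`); so every
`σ₁, σ₂ ≥ 0` are admissible constants for a flat `Rm`, and the covariant twin specialises to the flat member. [folklore] -/
theorem sf_binder_of_flat (hflat : ∀ b i j, Rm b i j = if i = j then (1 : ℝ) else 0) (θ : ℝ) {σ₁ σ₂ : ℝ} (hσ₁ : 0 ≤ σ₁)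
    (hσ₂ : 0 ≤ σ₂) :
    ∀ (x₀ : UT N) (R : ℕ), 1 ≤ R → (R : ℝ) ≤ (siteScale S hS hdivS lvl zc hcover x₀ : ℝ) * θ / 4 →
      (siteScale S hS hdivS lvl zc hcover x₀ : ℝ) * θ / 4 < R + 1 → ∃ g : UT N → Cp → Cp → ℝ, ∃ Rg : UT N × Fin d → Cp → Cp → ℝ,
      (∀ x i j, ∑ k, g x k i * g x k j = if i = j then (1 : ℝ) else 0) ∧
      (∀ b i j, Rg b i j = ∑ k, g (bsrc b) i k * ∑ l, Rm b k l * g (btgt b) j l) ∧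
      (∀ b : UT N × Fin d, dist (bsrc b) x₀ ≤ 2 * R + 3 → ∀ v : Cp → ℝ,
        Real.sqrt (∑ i, (∑ j, (Rg b i j - if i = j then (1 : ℝ) else 0) * v j) ^ 2) ≤
          σ₁ / ((R : ℝ) + 1) * Real.sqrt (∑ j, v j ^ 2)) ∧
      (∀ x ∈ univ.filter (fun x : UT N => dist x x₀ ≤ 2 * R + 2), ∀ μ (v : Cp → ℝ),
        Real.sqrt (∑ i, (∑ j, (Rg (dn x μ, μ) i j - Rg (x, μ) i j) * v j) ^ 2) ≤
          σ₂ / ((R : ℝ) + 1) ^ 2 * Real.sqrt (∑ j, v j ^ 2)) := by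
  intro x₀ R _ _ _
  refine ⟨fun _ i j => if i = j then (1 : ℝ) else 0, Rm, ?_, ?_, ?_, ?_⟩
  · intro x i j
    exact CovariantLaplacianFlatSplit.flat_col_orth (fun (_ : Unit) i j => if i = j then (1 : ℝ) else 0)
      (fun _ _ _ => rfl) () i j
  · intro b i j
    simp only [hflat]
    simp only [mul_ite, mul_one, mul_zero, Finset.sum_ite_eq, Finset.sum_ite_eq', Finset.mem_univ, if_true]
  · intro b _ v
    have h0 : ∀ i, (∑ j, (Rm b i j - if i = j then (1 : ℝ) else 0) * v j) = 0 := fun i => by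
      refine Finset.sum_eq_zero fun j _ => ?_
      rw [hflat, sub_self, zero_mul]
    simp only [h0]
    rw [show (∑ _i : Cp, (0 : ℝ) ^ 2) = 0 by simp, Real.sqrt_zero]
    positivity
  · intro x _ μ v
    have h0 : ∀ i, (∑ j, (Rm (dn x μ, μ) i j - Rm (x, μ) i j) * v j) = 0 := fun i => by
      refine Finset.sum_eq_zero fun j _ => ?_
      rw [hflat, hflat, sub_self, zero_mul]
    simp only [h0]
    rw [show (∑ _i : Cp, (0 : ℝ) ^ 2) = 0 by simp, Real.sqrt_zero]
    positivity

end Core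

end

end Summit.QuantumFields.BalabanUV.Beta.MultiscaleGradientCovariantLocal
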